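import Mathlib
import Summits.ValiantsHypothesis.ValiantsHypothesis.Theorems.GrenetZeonTwoDimCoefficientsScalingIndexReducingSubspace
import Summits.ValiantsHypothesis.ValiantsHypothesis.Theorems.GrenetZeonTwoDimCoefficientsScalingCodimLtPerGenericity

/-!
# Crux `GrenetZeon.TwoDimCoefficients` (stmt-ValiantsHypothesis-8062) / rung `DualUnipotentThreeHalves` (stmt-24318):
# scaling-closure — ★★★ the 3/2 rung `n³ ≤ 4m²` for every pencil that is INDEX-`n` UP TO CORANK `< n` (unconditional)

Unconditional extension of ✓ `cube_le_two_mul_sq_of_index` (p835662: nil-index `≤ n` ⇒ `n³ ≤ 2m²`) one step into the wild: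
if the nilpotent pencil `N` of a unipotent dual representation of `per_n` (`n ≥ 3`) becomes of nil-index `≤ n` after SOME linear
substitution `T` of corank `κ < n` — e.g. after killing fewer than `n` scalar garbage directions, or any `< n` hyperplane
sections — then `n³ ≤ 4m²`.  No hypothesis on the permanent side: the per-genericity input of the kernel bridge
(✓ `sq_sub_mul_le_of_indexReducingSubst`, p836011) is discharged by the SHARP per-genericity theorem
✓ `exists_mem_fullRank_hess0_perPoly_of_codim_lt` (p837946: the image of `T` contains a full-rank point of `Hess per_n`).

* ★★★ `cube_le_four_mul_sq_of_indexReducingSubst_corank_lt` — the statement above (per representation, explicit `T`).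

HONEST FRAMING: unconditional but PARTIAL — representations whose every index-`≤ n` section has corank `≥ n` (large
triangularisable garbage, memo NINETEENTH-HAND.md §8) are not covered; the 24318 decl, the stub `DualUnipotentBound`, crux 8062 and
`VP ≠ VNP` remain open.

References: T. Mignon, N. Ressayre, Int. Math. Res. Not. 2004:79, Thm. 1.1 (via the tree); folklore.
-/

-- single-conjunct layout `Summits/ValiantsHypothesis/ValiantsHypothesis`: the duplicated namespace
-- component is mandated by the tree.
set_option linter.dupNamespace false
set_option autoImplicit false

noncomputable section

namespace Summit.ValiantsHypothesis.ValiantsHypothesis.Theorems.GrenetZeonTwoDimCoefficients.ScalingClosure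

open MvPolynomial Matrix
open Literature.Computability.AlgebraicComplexity
open Literature.Algebra.Polynomial
open Summit.ValiantsHypothesis.ValiantsHypothesis.Cruxes.TwoDimCoefficients.DimTwoCases

section IndexUpToCorankLt

/-- ★★★ **Index `n` up to corank `< n` ⟹ `n³ ≤ 4m²`.**  For a unipotent dual representation of `per_n` (`n ≥ 3`) in pencil form
`A = A₀(1 − N)` and a linear substitution `T` with `(N ∘ T)ⁿ = 0` and `n² ≤ rank T + κ`, `κ < n`:  `n³ ≤ 4m²`.  (Bridge
✓ `sq_sub_mul_le_of_indexReducingSubst` at a full-rank point of `Hess per_n` inside `im T`, which exists by the sharp per-genericity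
theorem ✓ `exists_mem_fullRank_hess0_perPoly_of_codim_lt`.) [cite: MignonRessayre2004, Thm. 1.1 — via the tree; folklore] -/
theorem cube_le_four_mul_sq_of_indexReducingSubst_corank_lt {n m : ℕ} (hn : 3 ≤ n) (A B : AffMat n m) (hA : IsAffine A)
    (hB : IsAffine B) (α β c : ℂ) (hc : c ≠ 0) (hβ : β ≠ 0) (hdet : A.det = MvPolynomial.C c)
    (hper : perPoly (Fin n) ℂ = MvPolynomial.C α * A.det + MvPolynomial.C β * (A.adjugate * B).trace)
    (A₀ P₀ : Matrix (Fin m) (Fin m) ℂ) (hP₀ : A₀ * P₀ = 1) (N : AffMat n m)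
    (hN : ∀ i j, (N i j).IsHomogeneous 1) (hAN : A = A₀.map MvPolynomial.C * (1 - N))
    (T : Matrix (Fin n × Fin n) (Fin n × Fin n) ℂ) (hTn : (N.map (bind₁ (linSubst T))) ^ n = 0)
    {κ : ℕ} (hκ : n ^ 2 ≤ T.rank + κ) (hκn : κ < n) :
    n ^ 3 ≤ 4 * m ^ 2 := by
  classical
  -- a full-rank point of `Hess per_n` in the image of `T`
  have hV : n ^ 2 ≤ Module.finrank ℂ (LinearMap.range T.mulVecLin) + κ := hκ
  obtain ⟨z, hz, hrank⟩ :=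
    exists_mem_fullRank_hess0_perPoly_of_codim_lt (by omega) (LinearMap.range T.mulVecLin) κ hV hκn
  obtain ⟨w, hw⟩ := LinearMap.mem_range.mp hz
  have hκ' : n ^ 2 ≤ (hess0 (transl (T.mulVec w) (perPoly (Fin n) ℂ))).rank + 0 := by
    rw [← Matrix.mulVecLin_apply, hw, hrank, add_zero]
  have h := sq_sub_mul_le_of_indexReducingSubst (by omega) A B hA hB α β c hc hβ hdet hper A₀ P₀ hP₀ N hN hAN T
    hTn hκ w hκ'
  have h4 : 4 * κ ≤ n ^ 2 := by nlinarith
  have h1 : n ^ 2 ≤ 2 * (n ^ 2 - 0 - 2 * κ) := by omega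
  calc n ^ 3 = n ^ 2 * n := by ring
    _ ≤ 2 * (n ^ 2 - 0 - 2 * κ) * n := Nat.mul_le_mul_right _ h1
    _ = 2 * ((n ^ 2 - 0 - 2 * κ) * n) := by ring
    _ ≤ 2 * (2 * m ^ 2) := Nat.mul_le_mul_left _ h
    _ = 4 * m ^ 2 := by ring

/-- ★★★ **Index `n` on a subspace of codimension `< n` ⟹ `n³ ≤ 4m²`** (subspace form of
`cube_le_four_mul_sq_of_indexReducingSubst_corank_lt`).  For a unipotent dual representation of `per_n` (`n ≥ 3`) in pencil form
`A = A₀(1 − N)`: if the nilpotent pencil is POINTWISE of nil-index `≤ n` on some linear subspace `U ≤ ℂ^{n×n}` of codimension `< n`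
(`N(u)ⁿ = 0` for all `u ∈ U`), then `n³ ≤ 4m²`.  (Take `T` = a linear projection onto `U`; `(N ∘ T)ⁿ` vanishes at every point,
hence as a polynomial matrix.)  This is the exact unconditional reach of the Hessian route after this hand: the open INDEX-COST
question is whether such a `U` exists for every representation in the regime `4m² < n³`. [cite: MignonRessayre2004, Thm. 1.1 — via
the tree; folklore] -/
theorem cube_le_four_mul_sq_of_indexLeOn_codim_lt {n m : ℕ} (hn : 3 ≤ n) (A B : AffMat n m) (hA : IsAffine A)
    (hB : IsAffine B) (α β c : ℂ) (hc : c ≠ 0) (hβ : β ≠ 0) (hdet : A.det = MvPolynomial.C c)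
    (hper : perPoly (Fin n) ℂ = MvPolynomial.C α * A.det + MvPolynomial.C β * (A.adjugate * B).trace)
    (A₀ P₀ : Matrix (Fin m) (Fin m) ℂ) (hP₀ : A₀ * P₀ = 1) (N : AffMat n m)
    (hN : ∀ i j, (N i j).IsHomogeneous 1) (hAN : A = A₀.map MvPolynomial.C * (1 - N))
    (U : Submodule ℂ (Fin n × Fin n → ℂ)) (hU : ∀ u ∈ U, (N.map (MvPolynomial.eval u)) ^ n = 0)
    (hUdim : n ^ 2 < Module.finrank ℂ U + n) :
    n ^ 3 ≤ 4 * m ^ 2 := by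
  classical
  -- a linear projection onto `U`, as a matrix
  obtain ⟨W, hUW⟩ := U.exists_isCompl
  set π : (Fin n × Fin n → ℂ) →ₗ[ℂ] (Fin n × Fin n → ℂ) := U.projection W hUW with hπ
  set T : Matrix (Fin n × Fin n) (Fin n × Fin n) ℂ := LinearMap.toMatrix' π with hT
  have hTx : ∀ x, T.mulVec x = π x := fun x => by
    rw [← Matrix.toLin'_apply, hT, Matrix.toLin'_toMatrix']
  have hTmem : ∀ x, T.mulVec x ∈ U := fun x => by
    rw [hTx, hπ]
    exact Submodule.projection_apply_mem hUW x
  have hTfix : ∀ u ∈ U, T.mulVec u = u := fun u hu => by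
    rw [hTx, hπ]
    exact Submodule.projection_apply_left hUW ⟨u, hu⟩
  -- rank: `U ≤ range T`
  have hUle : U ≤ LinearMap.range T.mulVecLin := fun u hu =>
    LinearMap.mem_range.mpr ⟨u, by rw [Matrix.mulVecLin_apply, hTfix u hu]⟩
  have hrank : Module.finrank ℂ U ≤ T.rank := Submodule.finrank_mono hUle
  have hUn : Module.finrank ℂ U ≤ n ^ 2 := by
    have := Submodule.finrank_le U
    rw [Module.finrank_fintype_fun_eq_card, Fintype.card_prod, Fintype.card_fin, ← sq] at this
    exact this
  -- `(N ∘ T)ⁿ = 0` as a polynomial matrix: it vanishes at every point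
  have hkey : ∀ x : Fin n × Fin n → ℂ,
      ((N.map (bind₁ (linSubst T))) ^ n).map (MvPolynomial.eval x) = (N.map (MvPolynomial.eval (T.mulVec x))) ^ n := by
    intro x
    rw [← RingHom.mapMatrix_apply, map_pow, RingHom.mapMatrix_apply]
    congr 1
    ext i j
    simp only [Matrix.map_apply]
    exact eval_bind₁_linSubst T x (N i j)
  have hTn : (N.map (bind₁ (linSubst T))) ^ n = 0 := by
    refine Matrix.ext fun i j => ?_
    apply MvPolynomial.funext
    intro x
    have h := congrFun (congrFun (hkey x) i) j
    rw [Matrix.map_apply] at h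
    rw [h, hU _ (hTmem x), Matrix.zero_apply, Matrix.zero_apply, map_zero]
  exact cube_le_four_mul_sq_of_indexReducingSubst_corank_lt hn A B hA hB α β c hc hβ hdet hper A₀ P₀ hP₀ N hN hAN T hTn
    (κ := n ^ 2 - Module.finrank ℂ U) (by omega) (by omega)

/-- ★★★ **Ideal form: `Nⁿ ≡ 0 mod fewer than `n` linear forms ⟹ n³ ≤ 4m²`.**  For a unipotent dual representation of `per_n`
(`n ≥ 3`) in pencil form `A = A₀(1 − N)`: if every entry of `Nⁿ` lies in the ideal generated by `κ < n` linear forms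
`ℓ_t = Σ_c a_{t,c} X_c`, then `n³ ≤ 4m²` (the common kernel of the `ℓ_t` is a subspace of codimension `≤ κ` on which `N` is
pointwise of nil-index `≤ n`; ✓ `cube_le_four_mul_sq_of_indexLeOn_codim_lt`).  Examples: `Nⁿ = 0` (p835662, `κ = 0`); pencils
padded with `< n` scalar garbage blocks `ℓ_t·J`. [cite: MignonRessayre2004, Thm. 1.1 — via the tree; folklore] -/
theorem cube_le_four_mul_sq_of_pow_mem_ideal_span_lt {n m κ : ℕ} (hn : 3 ≤ n) (A B : AffMat n m) (hA : IsAffine A)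
    (hB : IsAffine B) (α β c : ℂ) (hc : c ≠ 0) (hβ : β ≠ 0) (hdet : A.det = MvPolynomial.C c)
    (hper : perPoly (Fin n) ℂ = MvPolynomial.C α * A.det + MvPolynomial.C β * (A.adjugate * B).trace)
    (A₀ P₀ : Matrix (Fin m) (Fin m) ℂ) (hP₀ : A₀ * P₀ = 1) (N : AffMat n m)
    (hN : ∀ i j, (N i j).IsHomogeneous 1) (hAN : A = A₀.map MvPolynomial.C * (1 - N))
    (a : Fin κ → Fin n × Fin n → ℂ) (hκ : κ < n)
    (hideal : ∀ i j, (N ^ n) i j ∈ Ideal.span (Set.range fun t : Fin κ =>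
      ∑ c : Fin n × Fin n, MvPolynomial.C (a t c) * MvPolynomial.X c)) :
    n ^ 3 ≤ 4 * m ^ 2 := by
  classical
  -- the common kernel of the linear forms
  set Φ := (Matrix.of a).mulVecLin with hΦ
  set U : Submodule ℂ (Fin n × Fin n → ℂ) := LinearMap.ker Φ with hUdef
  have hUdim : n ^ 2 < Module.finrank ℂ U + n := by
    have hrn := LinearMap.finrank_range_add_finrank_ker Φ
    have hrange : Module.finrank ℂ (LinearMap.range Φ) ≤ κ := by
      have := Submodule.finrank_le (LinearMap.range Φ)
      rw [Module.finrank_fintype_fun_eq_card, Fintype.card_fin] at this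
      exact this
    rw [Module.finrank_fintype_fun_eq_card, Fintype.card_prod, Fintype.card_fin, ← sq] at hrn
    rw [hUdef]
    omega
  refine cube_le_four_mul_sq_of_indexLeOn_codim_lt hn A B hA hB α β c hc hβ hdet hper A₀ P₀ hP₀ N hN hAN U ?_ hUdim
  intro u hu
  have hu' : ∀ t, ∑ c', a t c' * u c' = 0 := fun t => by
    have h := congrFun (LinearMap.mem_ker.mp hu) t
    rw [Matrix.mulVecLin_apply, Matrix.mulVec, dotProduct] at h
    simpa [Matrix.of_apply] using h
  -- every generator, hence the whole ideal, dies under `eval u`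
  have hgen : Ideal.span (Set.range fun t : Fin κ => ∑ c' : Fin n × Fin n, MvPolynomial.C (a t c') * MvPolynomial.X c')
      ≤ RingHom.ker (MvPolynomial.eval u) := by
    rw [Ideal.span_le]
    rintro _ ⟨t, rfl⟩
    rw [SetLike.mem_coe, RingHom.mem_ker, map_sum]
    simp only [map_mul, MvPolynomial.eval_C, MvPolynomial.eval_X]
    exact hu' t
  have hpow : (N.map (MvPolynomial.eval u)) ^ n = (N ^ n).map (MvPolynomial.eval u) := by
    rw [← RingHom.mapMatrix_apply, ← RingHom.mapMatrix_apply, map_pow]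
  rw [hpow]
  ext i j
  rw [Matrix.map_apply, Matrix.zero_apply]
  exact RingHom.mem_ker.mp (hgen (hideal i j))

end IndexUpToCorankLt

end Summit.ValiantsHypothesis.ValiantsHypothesis.Theorems.GrenetZeonTwoDimCoefficients.ScalingClosure

end
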